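import Mathlib.Data.ZMod.Basic
import Mathlib.FieldTheory.Finite.Basic
import Mathlib.GroupTheory.QuotientGroup.Basic
import Mathlib.GroupTheory.Coset.Card
import Mathlib.GroupTheory.OrderOfElement
import Mathlib.GroupTheory.GroupAction.Quotient
import Mathlib.Data.Fintype.Option
import HarnessLib

/-!
# The label sets `F_l^⋇`, `|F_l|` and `F_l^⋇`-torsors ([IUTchI] §4, "Multiplicative Combinatorial
# Teichmüller Theory") — abc-iut cell, layer L5, statements-first

Mochizuki, *Inter-universal Teichmüller theory I: construction of Hodge theaters*, §4 (kurims
May-2020 manuscript, pp. 95–122). This file holds the part of §4 that is PURE FINITE COMBINATORICS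
and needs no anabelian input; every item is proved.

* p. 95: the labels `∈ F_l^⋇ := F_lˣ/{±1}`, "the set `F_l^⋇` is of cardinality `l^⋇ := (l-1)/2`"
  (`FlStar`, `lStar`, `card_flStar`);
* Example 4.4 (i) p. 105–106: `|F_l| := F_l/{±1} = 0 ∪ F_l^⋇` (`FlAbs`, `flAbsEquivOption`);
* Definition 4.1 (ii) p. 96 / Proposition 4.2 p. 98: the "natural `F_l^⋇`-torsor structure" with a
  "canonical element" and the bijections it determines (`IsTorsor`, `labelEquiv`,
  `existsUnique_pointed_torsor_equiv` = the abstract core of Prop. 4.2: pointed `F_l^⋇`-torsors are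
  uniquely isomorphic, compatibly with any third one);
* Remark 4.2.1 p. 98 (mechanism only): a family of bijections compatible with componentwise
  automorphisms cannot exist when one automorphism group acts transitively on a set with `≥ 2`
  elements and another acts trivially (`no_compatible_bijection`); the number-theoretic input of the
  Remark (Tchebotarev: such a place `v` exists) is NOT formalised here;

The label-indeterminacy counts of Prop. 4.9 (ii), Prop. 4.11 (i) and Remark 4.9.2 (iii) are in
`Processions.lean`.
The `D`-prime-strips, bridges and Hodge theaters of §4 (Definitions 4.1, 4.6, …) are typed over an
interface in the companion files `BasePrimeStrips.lean`, `BaseBridges.lean`, `Processions.lean`.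
Nothing here asserts or uses any disputed claim; the bibliographic key of the series carries the
D-0012 status, hence the tag form [claim: Mochizuki2012, status: disputed].
-/

namespace Literature.IUT.HodgeTheaters

open scoped Nat

/-! ### `F_l^⋇ = F_lˣ/{±1}` and `l^⋇ = (l-1)/2` (p. 95) -/

section Labels

variable (l : ℕ)

/-- The subgroup `{±1} ⊆ F_lˣ`. ([IUTchI] §4 p. 95: "`F_l^⋇ := F_lˣ/{±1}`".)
[claim: Mochizuki2012, status: disputed] -/
def unitsPlusMinus : Subgroup (ZMod l)ˣ where
  carrier := {1, -1}
  one_mem' := by simp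
  mul_mem' := by
    rintro a b (rfl | rfl) (rfl | rfl) <;> simp
  inv_mem' := by
    rintro a (rfl | rfl)
    · simp
    · exact Or.inr inv_neg_one

/-- `F_l^⋇ := F_lˣ/{±1}`, the set of LABELS of [IUTchI] §4 (p. 95), a commutative group under
multiplication. [claim: Mochizuki2012, status: disputed] -/
abbrev FlStar : Type := (ZMod l)ˣ ⧸ unitsPlusMinus l

/-- `l^⋇ := (l-1)/2` ([IUTchI] §4 p. 95). [claim: Mochizuki2012, status: disputed] -/
def lStar : ℕ := (l - 1) / 2

/-- The label `∈ F_l^⋇` of a unit `∈ F_lˣ`. [claim: Mochizuki2012, status: disputed] -/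
abbrev FlStar.mk (u : (ZMod l)ˣ) : FlStar l := (u : FlStar l)

/-- Membership in `{±1}`. [claim: Mochizuki2012, status: disputed] -/
theorem mem_unitsPlusMinus_iff {l : ℕ} (u : (ZMod l)ˣ) :
    u ∈ unitsPlusMinus l ↔ u = 1 ∨ u = -1 := Iff.rfl

/-- For a prime `l ≠ 2`, `{±1} ⊆ F_lˣ` has exactly two elements. [claim: Mochizuki2012, status: disputed] -/
theorem card_unitsPlusMinus [Fact l.Prime] (hl : l ≠ 2) : Nat.card (unitsPlusMinus l) = 2 := by
  have h2 : Fact (2 < l) := ⟨lt_of_le_of_ne (Fact.out : l.Prime).two_le (Ne.symm hl)⟩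
  have hne : (1 : (ZMod l)ˣ) ≠ -1 := by
    intro h
    have := congrArg (fun u : (ZMod l)ˣ => (u : ZMod l)) h
    simp only [Units.val_neg, Units.val_one] at this
    exact ZMod.neg_one_ne_one this.symm
  change Nat.card (({1, -1} : Set (ZMod l)ˣ)) = 2
  rw [Nat.card_coe_set_eq, Set.ncard_pair hne]

/-- "the set `F_l^⋇` is of cardinality `l^⋇ := (l-1)/2`" ([IUTchI] §4 p. 95), for a prime `l ≠ 2`.
[claim: Mochizuki2012, status: disputed] -/
theorem card_flStar [Fact l.Prime] (hl : l ≠ 2) : Nat.card (FlStar l) = lStar l := by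
  have h := Subgroup.card_eq_card_quotient_mul_card_subgroup (unitsPlusMinus l)
  rw [card_unitsPlusMinus l hl, Nat.card_eq_fintype_card, ZMod.card_units] at h
  rw [lStar, h, Nat.mul_div_cancel _ two_pos]

/-- Under the standing assumption `l ≥ 5` of [IUTchI] Def. 3.1 (c), `l^⋇ ≥ 2`.
[claim: Mochizuki2012, status: disputed] -/
theorem two_le_lStar {l : ℕ} (hl : 5 ≤ l) : 2 ≤ lStar l := by
  unfold lStar; omega

/-- `F_l^⋇` is finite (for `l ≠ 0`). [claim: Mochizuki2012, status: disputed] -/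
instance [NeZero l] : Finite (FlStar l) := Quotient.finite _

/-! ### `|F_l| = F_l/{±1} = 0 ∪ F_l^⋇` (Example 4.4 (i), p. 105) -/

/-- The equivalence relation `x ∼ ±x` on `F_l`, i.e. the orbit relation of `{±1} ⊆ F_lˣ` acting by
multiplication. [claim: Mochizuki2012, status: disputed] -/
def plusMinusSetoid : Setoid (ZMod l) := MulAction.orbitRel (unitsPlusMinus l) (ZMod l)

/-- `|F_l| := F_l/{±1}`, "the set of `{±1}`-orbits of `F_l`" ([IUTchI] Example 4.4 (i), p. 105–106):
the labels of cusps of `X_v`, including the zero label. [claim: Mochizuki2012, status: disputed] -/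
def FlAbs : Type := Quotient (plusMinusSetoid l)

/-- The class in `|F_l|` of an element of `F_l`. [claim: Mochizuki2012, status: disputed] -/
def FlAbs.mk (x : ZMod l) : FlAbs l := Quotient.mk (plusMinusSetoid l) x

/-- The zero label `0 ∈ |F_l|` ([IUTchI] Example 4.4 (i): "the cusp labeled `0 ∈ |F_l|`").
[claim: Mochizuki2012, status: disputed] -/
def FlAbs.zero : FlAbs l := FlAbs.mk l 0

/-- `x ∼ y` in `F_l/{±1}` iff `x = ±y`. [claim: Mochizuki2012, status: disputed] -/
theorem plusMinusSetoid_rel_iff {l : ℕ} {x y : ZMod l} :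
    (plusMinusSetoid l).r x y ↔ x = y ∨ x = -y := by
  change x ∈ MulAction.orbit (unitsPlusMinus l) y ↔ _
  rw [MulAction.mem_orbit_iff]
  constructor
  · rintro ⟨⟨u, hu⟩, rfl⟩
    rcases (mem_unitsPlusMinus_iff u).1 hu with rfl | rfl
    · left; simp
    · right
      change ((-1 : (ZMod l)ˣ) : ZMod l) * y = -y
      simp
  · rintro (rfl | rfl)
    · exact ⟨1, one_smul _ _⟩
    · refine ⟨⟨-1, (mem_unitsPlusMinus_iff _).2 (Or.inr rfl)⟩, ?_⟩
      change ((-1 : (ZMod l)ˣ) : ZMod l) * y = -y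
      simp

/-- Two elements of `F_l` have the same class in `|F_l|` iff they agree up to sign ([IUTchI] Ex. 4.4 (i)). [claim: Mochizuki2012, status: disputed] -/
theorem FlAbs.mk_eq_mk_iff {l : ℕ} {x y : ZMod l} :
    FlAbs.mk l x = FlAbs.mk l y ↔ x = y ∨ x = -y :=
  ⟨fun h => plusMinusSetoid_rel_iff.1 (Quotient.exact h),
    fun h => Quotient.sound (plusMinusSetoid_rel_iff.2 h)⟩

/-- Every label class is the class of some element of `F_l`. [claim: Mochizuki2012, status: disputed] -/
theorem FlAbs.mk_surjective : Function.Surjective (FlAbs.mk l) :=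
  Quotient.mk_surjective

/-- The natural map `F_l^⋇ → |F_l|` (a label class of units is a label class).
[claim: Mochizuki2012, status: disputed] -/
def FlStar.toFlAbs : FlStar l → FlAbs l :=
  Quotient.lift (fun u : (ZMod l)ˣ => FlAbs.mk l (u : ZMod l)) (by
    intro u w huw
    have huw' : u⁻¹ * w ∈ unitsPlusMinus l := QuotientGroup.leftRel_apply.mp huw
    rcases (mem_unitsPlusMinus_iff _).1 huw' with h | h
    · rw [inv_mul_eq_one] at h; rw [h]
    · have : w = -u := by
        rw [inv_mul_eq_iff_eq_mul] at h; rw [h]; simp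
      subst this
      exact (FlAbs.mk_eq_mk_iff).2 (Or.inr (by simp)))

/-- `F_l^⋇ → |F_l|` on representatives. [claim: Mochizuki2012, status: disputed] -/
@[simp] theorem FlStar.toFlAbs_mk (u : (ZMod l)ˣ) :
    FlStar.toFlAbs l (FlStar.mk l u) = FlAbs.mk l u := rfl

/-- `F_l^⋇ → |F_l|` is injective ("`|F_l| = 0 ∪ F_l^⋇`", [IUTchI] Ex. 4.4 (i) p. 105). [claim: Mochizuki2012, status: disputed] -/
theorem FlStar.toFlAbs_injective : Function.Injective (FlStar.toFlAbs l) := by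
  intro a b h
  induction a using QuotientGroup.induction_on with
  | H u =>
  induction b using QuotientGroup.induction_on with
  | H w =>
  change FlAbs.mk l u = FlAbs.mk l w at h
  rw [FlAbs.mk_eq_mk_iff] at h
  refine QuotientGroup.eq.mpr ((mem_unitsPlusMinus_iff _).2 ?_)
  rcases h with h | h
  · left
    rw [inv_mul_eq_one]
    exact Units.ext h
  · right
    rw [inv_mul_eq_iff_eq_mul]
    ext; simp [h]

/-- `F_l^⋇` misses the zero label ("`|F_l| = 0 ∪ F_l^⋇`", [IUTchI] Ex. 4.4 (i) p. 105), `l` prime. [claim: Mochizuki2012, status: disputed] -/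
theorem FlStar.toFlAbs_ne_zero [Fact l.Prime] (j : FlStar l) :
    FlStar.toFlAbs l j ≠ FlAbs.zero l := by
  induction j using QuotientGroup.induction_on with
  | H u =>
    change FlAbs.mk l u ≠ FlAbs.mk l 0
    rw [Ne, FlAbs.mk_eq_mk_iff, neg_zero, or_self]
    exact u.ne_zero

/-- `|F_l| = 0 ∪ F_l^⋇` ([IUTchI] Example 4.4 (i), p. 105): every nonzero label class is the class of a
unit, for `l` prime. [claim: Mochizuki2012, status: disputed] -/
theorem FlAbs.eq_zero_or_exists_eq [Fact l.Prime] (x : FlAbs l) :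
    x = FlAbs.zero l ∨ ∃ j : FlStar l, FlStar.toFlAbs l j = x := by
  obtain ⟨x, rfl⟩ := FlAbs.mk_surjective l x
  by_cases hx : x = 0
  · left; rw [hx]; rfl
  · right
    exact ⟨FlStar.mk l (Units.mk0 x hx), by simp⟩

/-- `|F_l| ≃ 0 ∪ F_l^⋇` as an explicit bijection with `Option F_l^⋇` (`none` = the zero label), for `l`
prime ([IUTchI] Example 4.4 (i), p. 105). [claim: Mochizuki2012, status: disputed] -/
noncomputable def flAbsEquivOption [Fact l.Prime] : FlAbs l ≃ Option (FlStar l) := by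
  classical
  refine (Equiv.ofBijective (fun o : Option (FlStar l) => o.elim (FlAbs.zero l) (FlStar.toFlAbs l))
    ⟨?_, ?_⟩).symm
  · rintro (_ | a) (_ | b) h
    · rfl
    · exact absurd h.symm (FlStar.toFlAbs_ne_zero l b)
    · exact absurd h (FlStar.toFlAbs_ne_zero l a)
    · exact congrArg some (FlStar.toFlAbs_injective l h)
  · intro x
    rcases FlAbs.eq_zero_or_exists_eq l x with rfl | ⟨j, rfl⟩
    · exact ⟨none, rfl⟩
    · exact ⟨some j, rfl⟩

/-- `|F_l|` has `l^⋇ + 1` elements, for a prime `l ≠ 2`. [claim: Mochizuki2012, status: disputed] -/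
theorem card_flAbs [Fact l.Prime] (hl : l ≠ 2) : Nat.card (FlAbs l) = lStar l + 1 := by
  classical
  haveI := Fintype.ofFinite (FlStar l)
  rw [Nat.card_congr (flAbsEquivOption l), Nat.card_eq_fintype_card, Fintype.card_option,
    ← Nat.card_eq_fintype_card, card_flStar l hl]

end Labels

/-! ### Torsors, canonical elements and the bijections of Proposition 4.2 (p. 96, p. 98) -/

section Torsors

variable (G : Type*) [Group G] (T : Type*) [MulAction G T]

/-- `T` is a `G`-TORSOR: the action is simply transitive ([IUTchI] Def. 4.1 (ii) p. 96: "`LabCusp(†𝔇_v)`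
admits a natural `F_l^⋇`-torsor structure"; also used with `G = 𝔖_n`, `F_l^{⋊±}` later in the series).
[claim: Mochizuki2012, status: disputed] -/
@[mk_iff] structure IsTorsor : Prop where
  /-- for any two points there is exactly one group element carrying the first to the second -/
  existsUnique_smul_eq : ∀ s t : T, ∃! g : G, g • s = t

variable {G T}

/-- The group itself, acting on itself by left multiplication, is a torsor.
[claim: Mochizuki2012, status: disputed] -/
theorem IsTorsor.self : IsTorsor G G :=
  ⟨fun s t => ⟨t * s⁻¹, by simp, fun _ hg => by rw [← hg]; simp⟩⟩

/-- In a torsor with a chosen ("canonical") element `η`, the position `g ↦ g • η` is a bijection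
`G ≃ T`. [claim: Mochizuki2012, status: disputed] -/
noncomputable def IsTorsor.orbitEquiv (h : IsTorsor G T) (η : T) : G ≃ T :=
  Equiv.ofBijective (fun g => g • η)
    ⟨fun _ g' hgg' => (h.existsUnique_smul_eq η (g' • η)).unique hgg' rfl,
      fun t => (h.existsUnique_smul_eq η t).exists⟩

/-- The orbit bijection is `g ↦ g • η`. [claim: Mochizuki2012, status: disputed] -/
@[simp] theorem IsTorsor.orbitEquiv_apply (h : IsTorsor G T) (η : T) (g : G) :
    h.orbitEquiv η g = g • η := rfl

/-- **The "natural bijection `LabCusp(†𝔇) ≃ F_l^⋇`" determined by a canonical element and a torsor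
structure** ([IUTchI] Prop. 4.2, second display, p. 98): `t ↦` the unique `g` with `g • η = t`; it
sends `η` to `1`. [claim: Mochizuki2012, status: disputed] -/
noncomputable def IsTorsor.labelEquiv (h : IsTorsor G T) (η : T) : T ≃ G := (h.orbitEquiv η).symm

/-- The label of `t` carries `η` to `t`. [claim: Mochizuki2012, status: disputed] -/
theorem IsTorsor.labelEquiv_smul (h : IsTorsor G T) (η : T) (t : T) :
    h.labelEquiv η t • η = t :=
  (h.orbitEquiv η).apply_symm_apply t

/-- The label of `g • η` is `g`. [claim: Mochizuki2012, status: disputed] -/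
@[simp] theorem IsTorsor.labelEquiv_smul_self (h : IsTorsor G T) (η : T) (g : G) :
    h.labelEquiv η (g • η) = g :=
  (h.orbitEquiv η).symm_apply_apply g

/-- The canonical element has label `1` ([IUTchI] Prop. 4.2, second display, p. 98). [claim: Mochizuki2012, status: disputed] -/
@[simp] theorem IsTorsor.labelEquiv_self (h : IsTorsor G T) (η : T) : h.labelEquiv η η = 1 := by
  simpa using h.labelEquiv_smul_self η 1

/-- The label bijection is equivariant for left multiplication: `label(g • t) = g · label(t)`.
[claim: Mochizuki2012, status: disputed] -/
theorem IsTorsor.labelEquiv_smul_eq_mul (h : IsTorsor G T) (η : T) (g : G) (t : T) :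
    h.labelEquiv η (g • t) = g * h.labelEquiv η t := by
  conv_lhs => rw [← h.labelEquiv_smul η t, smul_smul]
  exact h.labelEquiv_smul_self η _

variable {T' : Type*} [MulAction G T'] {T'' : Type*} [MulAction G T'']

/-- **Proposition 4.2, first display (abstract core)** ([IUTchI] p. 98): between two `G`-torsors with
canonical elements `η, η'` there is a bijection compatible with `η ↦ η'` and with the torsor
structures … [claim: Mochizuki2012, status: disputed] -/
noncomputable def IsTorsor.pointedEquiv (h : IsTorsor G T) (h' : IsTorsor G T') (η : T) (η' : T') :
    T ≃ T' :=
  (h.labelEquiv η).trans (h'.labelEquiv η').symm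

/-- Formula for the bijection of Prop. 4.2: `t ↦ label(t) • η'`. [claim: Mochizuki2012, status: disputed] -/
@[simp] theorem IsTorsor.pointedEquiv_apply (h : IsTorsor G T) (h' : IsTorsor G T') (η : T) (η' : T')
    (t : T) : h.pointedEquiv h' η η' t = h.labelEquiv η t • η' := rfl

/-- The bijection of Prop. 4.2 is "compatible with the assignments `†η_v ↦ †η_w`" ([IUTchI] p. 98). [claim: Mochizuki2012, status: disputed] -/
theorem IsTorsor.pointedEquiv_self (h : IsTorsor G T) (h' : IsTorsor G T') (η : T) (η' : T') :
    h.pointedEquiv h' η η' η = η' := by simp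

/-- The bijection of Prop. 4.2 is compatible "with the `F_l^⋇`-torsor structures on either side" ([IUTchI] p. 98). [claim: Mochizuki2012, status: disputed] -/
theorem IsTorsor.pointedEquiv_smul (h : IsTorsor G T) (h' : IsTorsor G T') (η : T) (η' : T')
    (g : G) (t : T) : h.pointedEquiv h' η η' (g • t) = g • h.pointedEquiv h' η η' t := by
  simp [h.labelEquiv_smul_eq_mul, mul_smul]

/-- … and it is UNIQUELY DETERMINED by these two conditions ([IUTchI] Prop. 4.2 p. 98: "bijections …
uniquely determined by the condition that they be compatible with the assignments `†η_v ↦ †η_w` as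
well as with the `F_l^⋇`-torsor structures on either side"). [claim: Mochizuki2012, status: disputed] -/
theorem IsTorsor.existsUnique_pointed_equiv (h : IsTorsor G T) (h' : IsTorsor G T') (η : T) (η' : T') :
    ∃! b : T ≃ T', b η = η' ∧ ∀ (g : G) (t : T), b (g • t) = g • b t := by
  refine ⟨h.pointedEquiv h' η η', ⟨h.pointedEquiv_self h' η η', h.pointedEquiv_smul h' η η'⟩, ?_⟩
  rintro b ⟨hb, hb'⟩
  ext t
  rw [IsTorsor.pointedEquiv_apply, ← hb, ← hb', h.labelEquiv_smul]

/-- The bijections of Prop. 4.2 are compatible among three torsors ("by identifying the various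
`LabCusp(†𝔇_v)` via these bijections, it makes sense to write `LabCusp(†𝔇)`", [IUTchI] p. 98): the
composite `T → T' → T''` is the bijection `T → T''`. [claim: Mochizuki2012, status: disputed] -/
theorem IsTorsor.pointedEquiv_trans (h : IsTorsor G T) (h' : IsTorsor G T') (h'' : IsTorsor G T'')
    (η : T) (η' : T') (η'' : T'') :
    (h.pointedEquiv h' η η').trans (h'.pointedEquiv h'' η' η'') = h.pointedEquiv h'' η η'' := by
  ext t; simp

/-- **Remark 4.2.1 (mechanism)** ([IUTchI] p. 98): if the automorphisms at `v` act TRANSITIVELY on a label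
set `T` with at least two elements while the automorphisms at `w` act TRIVIALLY on `T'`, then no bijection
`T ≃ T'` is compatible with all pairs of automorphisms (as a bijection "preserved by arbitrary
isomorphisms of `𝒟`-prime-strips" would have to be, automorphisms of a prime-strip being chosen
independently at each place). The arithmetic input of the Remark — by Tchebotarev, replacing `X→_v` by
`C_v` produces such a `v` — is not formalised here. [claim: Mochizuki2012, status: disputed] -/
theorem no_compatible_bijection {A : Type*} [Group A] [MulAction A T] [MulAction.IsPretransitive A T]
    (hT : ∃ s s' : T, s ≠ s') (b : T ≃ T') :
    ¬ ∀ (a : A) (t : T), b (a • t) = b t := by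
  intro hb
  obtain ⟨s, s', hss'⟩ := hT
  obtain ⟨a, rfl⟩ := MulAction.exists_smul_eq A s s'
  exact hss' (b.injective (hb a s).symm)

end Torsors


end Literature.IUT.HodgeTheaters
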